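import Literature.AnabelianGeometry.SemiGraphs.UniformSplittingStrictlyCoherentProofs
import HarnessLib

/-!
# Galois-countability (T2) gives uniform splitting depth off finitely many components

Mochizuki, *Inter-universal Teichmüller theory I*, Rmk. 2.5.3 (i) (T2) p. 52 (Galois-countable
semi-graphs of anabelioids) and (ii) (E7) p. 54 ("In … [SemiAnbd] 3.5, 3.6, 3.7, 3.8, 3.9, one must
assume that all … semi-graphs of anabelioids that appear are Galois-countable")
[cite: Mochizuki2012, IUTchI Rem. 2.5.3(i)(T2) p.52], combined with quasi-coherence ([SemiAnbd]
Def. 2.3 (iii) p. 25) [cite: MochizukiSemiAnbd2006, Def 2.3(iii) p.25].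

PROOF-ONLY file (no definitions; statement files untouched). It supplies the uniformity that the
proof of [SemiAnbd] Prop. 3.6 (v) (p. 40, "it follows from the coherence of `G` that there exists a
finite étale covering `H~ → G` whose pull-back to `G'` splits …") needs for a coherent but not
strictly coherent `G`: **(T2)-uniformity** (`exists_uniform_fixator_V` / `exists_uniform_fixator_E`)
— for `G` quasi-coherent and Galois-countable and every `K`, some finite étale covering `F` of `G`
with nonempty fibres has, off a FINITE set of vertices (resp. edges) `c`, its pointwise stabiliser
`Fix(F_c) ⊆ Π_c` (open, of index `≤ (deg F)!`) inside EVERY open subgroup of `Π_c` of index `≤ K`.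
Proof = a diagonal argument: if every member `F_i` of a (T2)-family had an infinite exceptional set,
choose pairwise distinct exceptional components `c_i` with witnesses `U_i ⊆ Π_{c_i}`
(`exists_injective_forall_mem`); quasi-coherence applied to the local coverings `Π_{c_i}/U_i` (trivial
elsewhere) yields an approximator whose trivialising covering is ONE finite étale covering of `G`
split by no `F_i` — contradicting (T2). Consumed by `UniformSplittingProofs.lean`
(`uniformSplitting_holds`, Prop. 3.6 (v) for every coherent `G`). Nothing here takes a side on
[IUTchIII] Cor. 3.12.
-/

noncomputable section

open CategoryTheory Topology

namespace Literature.AnabelianGeometry.SemiGraphs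

universe u

namespace ProfiniteSemiGraph

/-! ### 1. A diagonal choice of pairwise distinct elements in a sequence of infinite sets -/

section Diagonal

variable {α : Type*}

/-- From a sequence of infinite sets one can choose pairwise distinct elements, the `i`-th in the
`i`-th set (the diagonal of the argument below: the `n`-th element is chosen in `E n` outside the
finite set of the earlier choices). [cite: Mochizuki2012, IUTchI Rem. 2.5.3(i)(T2) p.52] -/
theorem exists_injective_forall_mem (E : ℕ → Set α) (hE : ∀ i, (E i).Infinite) :
    ∃ d : ℕ → α, Function.Injective d ∧ ∀ i, d i ∈ E i := by
  classical
  let step : ℕ → Finset α → α := fun n s => ((hE n).exists_notMem_finset s).choose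
  have hstep : ∀ n s, step n s ∈ E n ∧ step n s ∉ s := fun n s =>
    ((hE n).exists_notMem_finset s).choose_spec
  let fin : ℕ → Finset α := fun n =>
    Nat.rec (motive := fun _ => Finset α) ∅ (fun k s => insert (step k s) s) n
  let d : ℕ → α := fun n => step n (fin n)
  have hsucc : ∀ n, fin (n + 1) = insert (d n) (fin n) := fun n => rfl
  have hmem : ∀ {m n : ℕ}, m < n → d m ∈ fin n := by
    intro m n h
    induction n with
    | zero => exact absurd h (Nat.not_lt_zero m)
    | succ n ih =>
      rw [hsucc, Finset.mem_insert]
      rcases Nat.lt_succ_iff_lt_or_eq.mp h with h | h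
      · exact Or.inr (ih h)
      · exact Or.inl (by rw [h])
  refine ⟨d, fun m n hmn => ?_, fun i => (hstep i (fin i)).1⟩
  by_contra hne
  rcases lt_or_gt_of_ne hne with h | h
  · have h1 : d m ∈ fin n := hmem h
    rw [hmn] at h1
    exact (hstep n (fin n)).2 h1
  · have h1 : d n ∈ fin m := hmem h
    rw [← hmn] at h1
    exact (hstep m (fin m)).2 h1

end Diagonal

variable {𝒢 : ProfiniteSemiGraph.{u}}

/-! ### 2. (T2)-uniformity: off finitely many components one finite étale covering of `G` is
deep enough at every bounded index -/

/-- **(T2)-uniformity at the vertices.** For `G` quasi-coherent (Def. 2.3 (iii)) and Galois-countable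
([IUTchI] Rmk. 2.5.3 (i) (T2)) and every `K`, there is a finite étale covering `F` of `G` with nonempty
fibres such that, for all but FINITELY many vertices `v`, the pointwise stabiliser of `F_v` in `Π_v`
lies in every open subgroup of `Π_v` of index `≤ K`. (Diagonal argument: were the exceptional set
infinite for every member `F_i` of a (T2)-family, distinct exceptional vertices `v_i` with witnesses
`U_i ⊆ Π_{v_i}` and quasi-coherence applied to the local coverings `Π_{v_i}/U_i` would give one finite
étale covering of `G` split by no `F_i`.) [cite: Mochizuki2012, IUTchI Rem. 2.5.3(i)(T2) p.52] -/
theorem exists_uniform_fixator_V (hqc : 𝒢.IsQuasiCoherent) (hgc : 𝒢.IsGaloisCountable) (K : ℕ) :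
    ∃ F : CovObj 𝒢, F.IsFinite ∧ F.HasNonemptyFibres ∧
      {v : 𝒢.graph.Vertex | ∃ N : Subgroup (𝒢.Gv v), IsOpen (N : Set (𝒢.Gv v)) ∧ N.index ≠ 0 ∧
        N.index ≤ K ∧ ¬ CovObj.fixator (F.SV v) ≤ N}.Finite := by
  classical
  obtain ⟨-, F, hF, hsplit⟩ := hgc
  by_contra hcon
  simp only [not_exists, not_and] at hcon
  -- for every `i` the exceptional set of `F i` is infinite
  let E : ℕ → Set 𝒢.graph.Vertex := fun i =>
    {v | ∃ N : Subgroup (𝒢.Gv v), IsOpen (N : Set (𝒢.Gv v)) ∧ N.index ≠ 0 ∧ N.index ≤ K ∧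
      ¬ CovObj.fixator ((F i).SV v) ≤ N}
  have hE : ∀ i, (E i).Infinite := fun i => hcon (F i) (hF i).1 (hF i).2
  obtain ⟨d, hd, hdE⟩ := exists_injective_forall_mem E hE
  -- witnesses at the chosen (pairwise distinct) vertices
  have hbad : ∀ v : 𝒢.graph.Vertex, (∃ i, d i = v) → ∃ N : Subgroup (𝒢.Gv v),
      IsOpen (N : Set (𝒢.Gv v)) ∧ N.index ≠ 0 ∧ N.index ≤ K ∧
        ∀ i, d i = v → ¬ CovObj.fixator ((F i).SV v) ≤ N := by
    rintro v ⟨i, rfl⟩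
    obtain ⟨N, hNo, hNi, hNK, hNf⟩ := hdE i
    refine ⟨N, hNo, hNi, hNK, fun j hj => ?_⟩
    obtain rfl : j = i := hd hj
    exact hNf
  choose N hNo hNi hNK hNf using hbad
  -- the family of local coverings fed to quasi-coherence: `Π_v/N_v` at the chosen vertices, trivial elsewhere
  let UV : ∀ v : 𝒢.graph.Vertex, Subgroup (𝒢.Gv v) := fun v =>
    if h : ∃ i, d i = v then N v h else ⊤
  have hUVo : ∀ v, IsOpen (UV v : Set (𝒢.Gv v)) := by
    intro v
    by_cases h : ∃ i, d i = v
    · simp only [UV, dif_pos h]; exact hNo v h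
    · simp only [UV, dif_neg h]; exact isOpen_univ
  have hUVi : ∀ v, (UV v).index ≠ 0 := by
    intro v
    by_cases h : ∃ i, d i = v
    · simp only [UV, dif_pos h]; exact hNi v h
    · simp only [UV, dif_neg h, Subgroup.index_top]; exact one_ne_zero
  have hUVK : ∀ v, (UV v).index ≤ max K 1 := by
    intro v
    by_cases h : ∃ i, d i = v
    · simp only [UV, dif_pos h]; exact (hNK v h).trans (le_max_left _ _)
    · simp only [UV, dif_neg h, Subgroup.index_top]; exact le_max_right _ _
  have hTo : ∀ e : 𝒢.graph.Edge, IsOpen ((⊤ : Subgroup (𝒢.Ge e)) : Set (𝒢.Ge e)) :=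
    fun _ => isOpen_univ
  have hTi : ∀ e : 𝒢.graph.Edge, (⊤ : Subgroup (𝒢.Ge e)).index ≠ 0 := fun _ => by
    rw [Subgroup.index_top]; exact one_ne_zero
  haveI : ∀ v, (UV v).FiniteIndex := fun v => ⟨hUVi v⟩
  haveI : ∀ e : 𝒢.graph.Edge, (⊤ : Subgroup (𝒢.Ge e)).FiniteIndex := fun e => ⟨hTi e⟩
  obtain ⟨A, hAV, -⟩ := hqc (max K 1) (fun v => CovObj.cosetsObj (UV v) (hUVo v) (hUVi v))
    (fun e => CovObj.cosetsObj ⊤ (hTo e) (hTi e))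
    (fun v => ⟨hUVK v, inferInstanceAs (Finite (𝒢.Gv v ⧸ UV v))⟩)
    (fun e => ⟨by
      change (⊤ : Subgroup (𝒢.Ge e)).index ≤ max K 1
      rw [Subgroup.index_top]; exact le_max_right _ _,
      inferInstanceAs (Finite (𝒢.Ge e ⧸ (⊤ : Subgroup (𝒢.Ge e))))⟩)
  -- the trivialising covering of the approximator is a finite étale covering split by no `F i`
  obtain ⟨M, hM, hdvd⟩ := A.bounded
  obtain ⟨i, hi⟩ := hsplit (A.trivCov hM hdvd) (A.trivCov_isFinite hM hdvd)
  have hv : ∃ j, d j = d i := ⟨i, rfl⟩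
  haveI : ∀ w, Finite ((F i).SV w).obj.V := (hF i).1.finite_V
  obtain ⟨x⟩ := (hF i).2.nonempty_V (d i)
  obtain ⟨z⟩ := (A.trivCov_hasNonemptyFibres hM hdvd).nonempty_V (d i)
  refine hNf (d i) hv i rfl fun g hg => ?_
  have hgx : ((F i).SV (d i)).obj.ρ g x = x := (CovObj.mem_fixator_iff _ g).mp hg x
  have hgz := hi.1 (d i) x g hgx z
  have hπ : A.πV (d i) g = 1 := CovObj.πV_eq_one_of_trivCov_ρ_eq A hM hdvd (d i) z g hgz
  have hgU : g ∈ UV (d i) :=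
    CovObj.mem_of_cosetsObj_fixed (UV (d i)) (hUVo (d i)) (hUVi (d i)) g (hAV (d i) g hπ)
  have hUN : UV (d i) = N (d i) hv := dif_pos hv
  rw [hUN] at hgU
  exact hgU

/-- **(T2)-uniformity at the edges** (as `exists_uniform_fixator_V`, with the local coverings placed
at exceptional edges). [cite: Mochizuki2012, IUTchI Rem. 2.5.3(i)(T2) p.52] -/
theorem exists_uniform_fixator_E (hqc : 𝒢.IsQuasiCoherent) (hgc : 𝒢.IsGaloisCountable) (K : ℕ) :
    ∃ F : CovObj 𝒢, F.IsFinite ∧ F.HasNonemptyFibres ∧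
      {e : 𝒢.graph.Edge | ∃ N : Subgroup (𝒢.Ge e), IsOpen (N : Set (𝒢.Ge e)) ∧ N.index ≠ 0 ∧
        N.index ≤ K ∧ ¬ CovObj.fixator (F.SE e) ≤ N}.Finite := by
  classical
  obtain ⟨-, F, hF, hsplit⟩ := hgc
  by_contra hcon
  simp only [not_exists, not_and] at hcon
  let E : ℕ → Set 𝒢.graph.Edge := fun i =>
    {e | ∃ N : Subgroup (𝒢.Ge e), IsOpen (N : Set (𝒢.Ge e)) ∧ N.index ≠ 0 ∧ N.index ≤ K ∧
      ¬ CovObj.fixator ((F i).SE e) ≤ N}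
  have hE : ∀ i, (E i).Infinite := fun i => hcon (F i) (hF i).1 (hF i).2
  obtain ⟨d, hd, hdE⟩ := exists_injective_forall_mem E hE
  have hbad : ∀ e : 𝒢.graph.Edge, (∃ i, d i = e) → ∃ N : Subgroup (𝒢.Ge e),
      IsOpen (N : Set (𝒢.Ge e)) ∧ N.index ≠ 0 ∧ N.index ≤ K ∧
        ∀ i, d i = e → ¬ CovObj.fixator ((F i).SE e) ≤ N := by
    rintro e ⟨i, rfl⟩
    obtain ⟨N, hNo, hNi, hNK, hNf⟩ := hdE i
    refine ⟨N, hNo, hNi, hNK, fun j hj => ?_⟩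
    obtain rfl : j = i := hd hj
    exact hNf
  choose N hNo hNi hNK hNf using hbad
  let UE : ∀ e : 𝒢.graph.Edge, Subgroup (𝒢.Ge e) := fun e =>
    if h : ∃ i, d i = e then N e h else ⊤
  have hUEo : ∀ e, IsOpen (UE e : Set (𝒢.Ge e)) := by
    intro e
    by_cases h : ∃ i, d i = e
    · simp only [UE, dif_pos h]; exact hNo e h
    · simp only [UE, dif_neg h]; exact isOpen_univ
  have hUEi : ∀ e, (UE e).index ≠ 0 := by
    intro e
    by_cases h : ∃ i, d i = e
    · simp only [UE, dif_pos h]; exact hNi e h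
    · simp only [UE, dif_neg h, Subgroup.index_top]; exact one_ne_zero
  have hUEK : ∀ e, (UE e).index ≤ max K 1 := by
    intro e
    by_cases h : ∃ i, d i = e
    · simp only [UE, dif_pos h]; exact (hNK e h).trans (le_max_left _ _)
    · simp only [UE, dif_neg h, Subgroup.index_top]; exact le_max_right _ _
  have hTo : ∀ v : 𝒢.graph.Vertex, IsOpen ((⊤ : Subgroup (𝒢.Gv v)) : Set (𝒢.Gv v)) :=
    fun _ => isOpen_univ
  have hTi : ∀ v : 𝒢.graph.Vertex, (⊤ : Subgroup (𝒢.Gv v)).index ≠ 0 := fun _ => by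
    rw [Subgroup.index_top]; exact one_ne_zero
  haveI : ∀ e, (UE e).FiniteIndex := fun e => ⟨hUEi e⟩
  haveI : ∀ v : 𝒢.graph.Vertex, (⊤ : Subgroup (𝒢.Gv v)).FiniteIndex := fun v => ⟨hTi v⟩
  obtain ⟨A, -, hAE⟩ := hqc (max K 1) (fun v => CovObj.cosetsObj ⊤ (hTo v) (hTi v))
    (fun e => CovObj.cosetsObj (UE e) (hUEo e) (hUEi e))
    (fun v => ⟨by
      change (⊤ : Subgroup (𝒢.Gv v)).index ≤ max K 1
      rw [Subgroup.index_top]; exact le_max_right _ _,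
      inferInstanceAs (Finite (𝒢.Gv v ⧸ (⊤ : Subgroup (𝒢.Gv v))))⟩)
    (fun e => ⟨hUEK e, inferInstanceAs (Finite (𝒢.Ge e ⧸ UE e))⟩)
  obtain ⟨M, hM, hdvd⟩ := A.bounded
  obtain ⟨i, hi⟩ := hsplit (A.trivCov hM hdvd) (A.trivCov_isFinite hM hdvd)
  have he : ∃ j, d j = d i := ⟨i, rfl⟩
  haveI : ∀ f, Finite ((F i).SE f).obj.V := (hF i).1.finite_E
  obtain ⟨x⟩ := (hF i).2.nonempty_E (d i)
  obtain ⟨z⟩ := (A.trivCov_hasNonemptyFibres hM hdvd).nonempty_E (d i)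
  refine hNf (d i) he i rfl fun g hg => ?_
  have hgx : ((F i).SE (d i)).obj.ρ g x = x := (CovObj.mem_fixator_iff _ g).mp hg x
  have hgz := hi.2 (d i) x g hgx z
  have hπ : A.πE (d i) g = 1 := CovObj.πE_eq_one_of_trivCov_ρ_eq A hM hdvd (d i) z g hgz
  have hgU : g ∈ UE (d i) :=
    CovObj.mem_of_cosetsObj_fixed (UE (d i)) (hUEo (d i)) (hUEi (d i)) g (hAE (d i) g hπ)
  have hUN : UE (d i) = N (d i) he := dif_pos he
  rw [hUN] at hgU
  exact hgU

end ProfiniteSemiGraph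

end Literature.AnabelianGeometry.SemiGraphs

end
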